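import Summits.AtomisticToContinuum.FouriersLaw.Theorems.EmbeddedDrudeMourreFiniteResponseOfUnique
import Summits.AtomisticToContinuum.FouriersLaw.Theorems.EmbeddedDrudeMourreAbelThermodynamicLimitAnchoredKuboPairCorrelations
import Summits.AtomisticToContinuum.FouriersLaw.Theorems.EmbeddedDrudeMourreAbelThermodynamicLimitAnchoredKuboFlatness
import Summits.AtomisticToContinuum.FouriersLaw.Theorems.OddSectorIrreversibilityOddDensityIsCorrectorMainPrep2
import Summits.AtomisticToContinuum.FouriersLaw.Theorems.OddSectorIrreversibilityOddDensityIsCorrectorDetailedBalance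
import HarnessLib

/-!
# `stub_anchoredKubo` of line `loomis-compact-horizon-witness`, part 4: from the per-bond Kubo response
(crux `EmbeddedDrudeMourre.AbelThermodynamicLimit`, item stmt-AtomisticToContinuum-12596;
`--supports` helper file for the registered stub S3 `stub_anchoredKubo`, closes nothing)

Isolates the ANALYTIC CORE of conjunct (2) of S3 (`T² Dn N = Σ_k ∫₀^∞ ⟨j_c(0) j_k(t)⟩_{N,T} dt`) as
the bare per-bond linear response in Kubo form: for every bond `i`,
`δ⁻¹(μ_δ(j_i) - μ_T(j_i)) → ∫₀^∞ ∫ g · P_s j_i dμ_T ds` (`δ → 0`, `δ ≠ 0`), `g = γ(p_0² - p_{N-1}²)/(2T²)`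
the McLennan source of the two-temperature perturbation `L_δ - L_0 = δ(γ/2)(∂²_{p_0} - ∂²_{p_{N-1}})`
(the output of any Hairer–Majda / Rey-Bellet linear-response theorem for the chain, e.g.
`pinnedChain_linear_response_of_uniformMixing` under `δ`-uniform CEHR (2.5) mixing), and proves
everything downstream of it, sorry-free:
* §5 `kuboResponse_eq_corrector_pairing`: `∫₀^∞ ∫ g · P_s j_i dμ_T ds = ((N-1)T²)⁻¹ ∫ j_i u⋆ dμ_T`
  (`u⋆ = ∫₀^∞ P_t J dt`): Fubini, zero-frequency detailed balance between the even `g` and the odd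
  `j_i` (resolvent identity `R_λ* = Θ R_λ Θ` + Abel limits with rate), the McLennan identity
  `R₀ g = μ_T(Ψ) - Ψ - R₀J/((N-1)T²)` a.e. (`Ψ` even; `OddDensityIsCorrector` parts 13–14), parity;
* `stub_anchoredKuboOfKuboResponse` (registered sub-goal): S3's hypotheses + the per-bond Kubo
  response ⇒ S3's conclusion (uniqueness of limits, §5, DC-flatness of part 2, Fubini of part 1).
References: Kundu–Dhar–Narayan 2009 (arXiv:0809.4543) (8)–(15), (reln2)–(reln3); Rey-Bellet 2003
Rem. 4.4; Cuneo–Eckmann–Hairer–Rey-Bellet 2018 Thm 2.13.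
-/

noncomputable section

open MeasureTheory ProbabilityTheory Filter Topology Set Function
open scoped NNReal ENNReal ContDiff

namespace Summit.AtomisticToContinuum.FouriersLaw.Theorems.AbelThermodynamicLimit.LoomisCompactHorizonWitness

open Literature.MathematicalPhysics.KineticTheory.HeatConduction
open Literature.MathematicalPhysics.KineticTheory OscillatorChain
open Literature.Barriers.AtomisticToContinuum.OpenChain
open Summit.AtomisticToContinuum.FouriersLaw.Theorems.SubdiffusiveBondHeat
open Summit.AtomisticToContinuum.FouriersLaw.Theorems.LightConeBondHeat
open Summit.AtomisticToContinuum.FouriersLaw.Theorems.OddSectorIrreversibility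
open Summit.AtomisticToContinuum.FouriersLaw.Theorems.OddSectorIrreversibility.Corrector

variable {N : ℕ}

/-! ## §5 The per-bond Kubo response value is the corrector pairing (McLennan / KDN identification) -/

section KuboResponse

variable {ω₂ lam β γ : ℝ} (hω : 0 < ω₂) (hl : 0 < lam) (hβ : 0 < β) (hγ : 0 < γ) (hN : 0 < N)
  {T : ℝ} (hT : 0 < T)
include hω hl hβ hγ hN hT

/-- **Fubini for the Kubo pairing, general kernel slot.** For nice `f` and a CENTRED nice `k`
(`|·| ≤ C e^{H/(4T)}`, `μ_T(k) = 0`), with `R₀ k(z) = ∫_{(0,∞)} P_t k(z) dt`: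
`t ↦ ∫ f · P_t k dμ_T` is integrable on `(0,∞)` and `∫_{(0,∞)} (∫ f · P_t k dμ_T) dt = ∫ f · R₀ k dμ_T`
(envelope `|P_t k| ≤ K C e^{ϑH} e^{-ct}`, CEHR (2.5)). [folklore] -/
theorem integral_crossCorr_eq_integral_mul_kubo {f k : PhaseSpace N → ℝ} (hf : Continuous f)
    {Cf : ℝ} (hfb : ∀ y, |f y| ≤ Cf * Real.exp (1 / (4 * T) * (pinnedChain ω₂ lam β γ).hamiltonian N y))
    (hk : Continuous k) {Ck : ℝ}
    (hkb : ∀ y, |k y| ≤ Ck * Real.exp (1 / (4 * T) * (pinnedChain ω₂ lam β γ).hamiltonian N y))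
    (hk0 : ∫ y, k y ∂((pinnedChain ω₂ lam β γ).gibbsMeasure N T) = 0) :
    IntegrableOn (fun t : ℝ => ∫ z, f z * (∫ y, k y
        ∂((pinnedChain ω₂ lam β γ).transitionKernel N T T t.toNNReal z))
      ∂((pinnedChain ω₂ lam β γ).gibbsMeasure N T)) (Ioi 0) ∧
    ∫ t in Ioi (0 : ℝ), ∫ z, f z * (∫ y, k y
          ∂((pinnedChain ω₂ lam β γ).transitionKernel N T T t.toNNReal z))
        ∂((pinnedChain ω₂ lam β γ).gibbsMeasure N T) =
      ∫ z, f z * (∫ t in Ioi (0 : ℝ), ∫ y, k y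
          ∂((pinnedChain ω₂ lam β γ).transitionKernel N T T t.toNNReal z))
        ∂((pinnedChain ω₂ lam β γ).gibbsMeasure N T) := by
  set P := pinnedChain ω₂ lam β γ with hP
  set μ := P.gibbsMeasure N T with hμ
  set κ : ℝ → Kernel (PhaseSpace N) (PhaseSpace N) := fun t => P.transitionKernel N T T t.toNNReal with hκ
  haveI : IsProbabilityMeasure μ := pinnedChain_isProbabilityMeasure_gibbsMeasure hω hl.le hβ.le γ N hT
  obtain ⟨hϑ0, h2ϑ⟩ := quarter_inv_temp_admissible hT
  set ϑ : ℝ := 1 / (4 * T) with hϑ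
  have hϑ1 : ϑ < 1 / T := by linarith
  have hCk : 0 ≤ Ck := nonneg_of_mul_nonneg_left ((abs_nonneg _).trans (hkb 0)) (Real.exp_pos _)
  obtain ⟨K, c, hK, hc, hb⟩ := pinnedChain_harris_bound hω hl.le hβ hγ hN hT hϑ0 hϑ1
  have hdecay : ∀ (z : PhaseSpace N) (t : ℝ), |∫ y, k y ∂(κ t z)| ≤
      K * Ck * Real.exp (ϑ * P.hamiltonian N z) * Real.exp (-c * t) := by
    intro z t
    have h := hb z t.toNNReal k hk Ck hCk hkb
    rw [hk0, sub_zero] at h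
    refine h.trans (mul_le_mul_of_nonneg_left (Real.exp_le_exp.2 ?_) (by positivity))
    have : t ≤ (t.toNNReal : ℝ) := Real.le_coe_toNNReal t
    nlinarith
  -- the joint integrand is integrable on `(0,∞) × μ_T`
  have hwint := pinnedChain_integrable_abs_mul_exp hω hl.le hβ hT h2ϑ hf hfb
  have hGm : AEStronglyMeasurable (fun q : ℝ × PhaseSpace N => f q.2 * ∫ y, k y ∂(κ q.1 q.2))
      ((volume.restrict (Ioi (0 : ℝ))).prod μ) :=
    ((hf.comp continuous_snd).stronglyMeasurable.mul
      (pinnedChain_stronglyMeasurable_act_uncurry hω hl.le hβ.le hγ.le T T hk.measurable)).aestronglyMeasurable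
  have hGint : Integrable (fun q : ℝ × PhaseSpace N => f q.2 * ∫ y, k y ∂(κ q.1 q.2))
      ((volume.restrict (Ioi (0 : ℝ))).prod μ) := by
    refine Integrable.mono' (((exp_neg_integrableOn_Ioi 0 hc).mul_prod (hwint.const_mul (K * Ck))))
      hGm (Eventually.of_forall fun q => ?_)
    rw [Real.norm_eq_abs, abs_mul]
    calc |f q.2| * |∫ y, k y ∂(κ q.1 q.2)|
        ≤ |f q.2| * (K * Ck * Real.exp (ϑ * P.hamiltonian N q.2) * Real.exp (-c * q.1)) :=
          mul_le_mul_of_nonneg_left (hdecay q.2 q.1) (abs_nonneg _)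
      _ = Real.exp (-c * q.1) * (K * Ck * (|f q.2| * Real.exp (ϑ * P.hamiltonian N q.2))) := by ring
  have hGint' : Integrable (uncurry fun z t => f z * ∫ y, k y ∂(κ t z))
      (μ.prod (volume.restrict (Ioi (0 : ℝ)))) := hGint.swap
  refine ⟨hGint.integral_prod_left, ?_⟩
  calc ∫ t in Ioi (0 : ℝ), ∫ z, f z * (∫ y, k y ∂(κ t z)) ∂μ
      = ∫ z, (∫ t in Ioi (0 : ℝ), f z * (∫ y, k y ∂(κ t z))) ∂μ := (integral_integral_swap hGint').symm
    _ = ∫ z, f z * (∫ t in Ioi (0 : ℝ), ∫ y, k y ∂(κ t z)) ∂μ := by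
        refine integral_congr_ae (Eventually.of_forall fun z => ?_)
        exact integral_const_mul (f z) _

/-- **Detailed balance at zero frequency between an even and an odd observable.** For a centred nice
EVEN `A` (`A∘Θ = A`) and a centred nice ODD `B` (`B∘Θ = -B`): `∫ A · R₀ B dμ_T = -∫ R₀ A · B dμ_T`
(`R₀ = ∫₀^∞ P_t dt`): the resolvent identity `∫ A · R_λ B dμ_T = ∫ R_λ(A∘Θ) · (B∘Θ) dμ_T`
(`pinnedChain_resolvent_detailed_balance`) and the Abel limits `R_λ → R₀` with rate `O(λ)`.
[cite: KunduDharNarayan2009, eq. (reln2)] -/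
theorem integral_mul_kubo_detailed_balance_even_odd (hN2 : 2 ≤ N) {A B : PhaseSpace N → ℝ}
    (hA : Continuous A) (hB : Continuous B) {CA CB : ℝ}
    (hAb : ∀ y, |A y| ≤ CA * Real.exp (1 / (4 * T) * (pinnedChain ω₂ lam β γ).hamiltonian N y))
    (hBb : ∀ y, |B y| ≤ CB * Real.exp (1 / (4 * T) * (pinnedChain ω₂ lam β γ).hamiltonian N y))
    (hA0 : ∫ y, A y ∂((pinnedChain ω₂ lam β γ).gibbsMeasure N T) = 0)
    (hB0 : ∫ y, B y ∂((pinnedChain ω₂ lam β γ).gibbsMeasure N T) = 0)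
    (hAeven : ∀ y : PhaseSpace N, A (y.1, -y.2) = A y) (hBodd : ∀ y : PhaseSpace N, B (y.1, -y.2) = -B y) :
    ∫ z, A z * (∫ t in Ioi (0 : ℝ), ∫ y, B y
        ∂((pinnedChain ω₂ lam β γ).transitionKernel N T T t.toNNReal z))
      ∂((pinnedChain ω₂ lam β γ).gibbsMeasure N T) =
    -∫ z, (∫ t in Ioi (0 : ℝ), ∫ y, A y
        ∂((pinnedChain ω₂ lam β γ).transitionKernel N T T t.toNNReal z)) * B z
      ∂((pinnedChain ω₂ lam β γ).gibbsMeasure N T) := by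
  set P := pinnedChain ω₂ lam β γ with hP
  set μ := P.gibbsMeasure N T with hμ
  haveI : IsProbabilityMeasure μ := pinnedChain_isProbabilityMeasure_gibbsMeasure hω hl.le hβ.le γ N hT
  obtain ⟨hϑ0, h2ϑ⟩ := quarter_inv_temp_admissible hT
  set ϑ : ℝ := 1 / (4 * T) with hϑ
  have hϑ1 : ϑ < 1 / T := by linarith
  have hCA : 0 ≤ CA := nonneg_of_mul_nonneg_left ((abs_nonneg _).trans (hAb 0)) (Real.exp_pos _)
  have hCB : 0 ≤ CB := nonneg_of_mul_nonneg_left ((abs_nonneg _).trans (hBb 0)) (Real.exp_pos _)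
  obtain ⟨K, c, hK, hc, hb⟩ := pinnedChain_harris_bound hω hl.le hβ hγ hN hT hϑ0 hϑ1
  set E : PhaseSpace N → ℝ := fun z => Real.exp (ϑ * P.hamiltonian N z) with hE
  -- notation: Kubo integrals `R₀` and resolvents `R_λ` of `A`, `B`
  set RA : PhaseSpace N → ℝ := fun z => ∫ t in Ioi (0 : ℝ), ∫ y, A y ∂(P.transitionKernel N T T t.toNNReal z) with hRA
  set RB : PhaseSpace N → ℝ := fun z => ∫ t in Ioi (0 : ℝ), ∫ y, B y ∂(P.transitionKernel N T T t.toNNReal z) with hRB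
  set RlA : ℝ → PhaseSpace N → ℝ := fun l z => ∫ t in Ioi (0 : ℝ), Real.exp (-(l * t)) *
    ∫ y, A y ∂(P.transitionKernel N T T t.toNNReal z) with hRlA
  set RlB : ℝ → PhaseSpace N → ℝ := fun l z => ∫ t in Ioi (0 : ℝ), Real.exp (-(l * t)) *
    ∫ y, B y ∂(P.transitionKernel N T T t.toNNReal z) with hRlB
  -- envelopes (`|R₀ f| ≤ KCE/c`, `|R_λ f - R₀ f| ≤ λKCE/c²`), measurability, weights
  have hRA_le : ∀ z, |RA z| ≤ 1 * ((K * CA * c) * E z) / c ^ 2 := fun z => by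
    have h := pinnedChain_abs_kubo_le hω hl.le hβ hγ hb hc hA hCA hAb hA0 z
    calc |RA z| ≤ K * CA * E z / c := h
      _ = _ := by field_simp
  have hRB_le : ∀ z, |RB z| ≤ 1 * ((K * CB * c) * E z) / c ^ 2 := fun z => by
    have h := pinnedChain_abs_kubo_le hω hl.le hβ hγ hb hc hB hCB hBb hB0 z
    calc |RB z| ≤ K * CB * E z / c := h
      _ = _ := by field_simp
  have hdA : ∀ {l : ℝ}, 0 < l → ∀ z, |RlA l z - RA z| ≤ l * ((K * CA) * E z) / c ^ 2 :=
    fun hl' z => pinnedChain_abs_resolvent_sub_kubo_le hω hl.le hβ hγ hϑ0 hb hc hA hCA hAb hA0 hl' z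
  have hdB : ∀ {l : ℝ}, 0 < l → ∀ z, |RlB l z - RB z| ≤ l * ((K * CB) * E z) / c ^ 2 :=
    fun hl' z => pinnedChain_abs_resolvent_sub_kubo_le hω hl.le hβ hγ hϑ0 hb hc hB hCB hBb hB0 hl' z
  have hRAm : AEStronglyMeasurable RA μ :=
    (pinnedChain_stronglyMeasurable_kubo hω hl.le hβ.le hγ.le T T hA.measurable).aestronglyMeasurable
  have hRBm : AEStronglyMeasurable RB μ :=
    (pinnedChain_stronglyMeasurable_kubo hω hl.le hβ.le hγ.le T T hB.measurable).aestronglyMeasurable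
  have hRlAm : ∀ l, AEStronglyMeasurable (RlA l) μ := fun l =>
    (pinnedChain_stronglyMeasurable_resolvent hω hl.le hβ.le hγ.le T T hA.measurable l).aestronglyMeasurable
  have hRlBm : ∀ l, AEStronglyMeasurable (RlB l) μ := fun l =>
    (pinnedChain_stronglyMeasurable_resolvent hω hl.le hβ.le hγ.le T T hB.measurable l).aestronglyMeasurable
  have hwA := pinnedChain_integrable_abs_mul_exp hω hl.le hβ hT h2ϑ hA hAb
  have hwB := pinnedChain_integrable_abs_mul_exp hω hl.le hβ hT h2ϑ hB hBb
  -- generic weighted estimate: `|∫ a d dμ| ≤ l (M/c²) ∫ |a| e^{ϑH}` whenever `|d| ≤ l M e^{ϑH}/c²`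
  have key : ∀ {a d : PhaseSpace N → ℝ}, Continuous a → AEStronglyMeasurable d μ → ∀ {M l : ℝ},
      Integrable (fun z => |a z| * E z) μ → (∀ z, |d z| ≤ l * (M * E z) / c ^ 2) →
      Integrable (fun z => a z * d z) μ ∧
      |∫ z, a z * d z ∂μ| ≤ l * (M / c ^ 2) * ∫ z, |a z| * E z ∂μ := by
    intro a d ha hdm M l hwa hd
    have hbd : ∀ z, ‖a z * d z‖ ≤ l * (M / c ^ 2) * (|a z| * E z) := fun z => by
      rw [Real.norm_eq_abs, abs_mul]
      calc |a z| * |d z| ≤ |a z| * (l * (M * E z) / c ^ 2) := mul_le_mul_of_nonneg_left (hd z) (abs_nonneg _)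
        _ = _ := by ring
    refine ⟨(hwa.const_mul _).mono' (ha.aestronglyMeasurable.mul hdm) (Eventually.of_forall hbd), ?_⟩
    have := norm_integral_le_of_norm_le (hwa.const_mul _) (Eventually.of_forall hbd)
    rwa [integral_const_mul, Real.norm_eq_abs] at this
  have hI1 := (key hA hRBm hwA hRB_le).1
  have hI2 := (key hB hRAm hwB hRA_le).1
  -- the resolvent identity at `λ > 0`: `∫ A · R_λ B = -∫ B · R_λ A`
  have hDB : ∀ {l : ℝ}, 0 < l → ∫ z, A z * RlB l z ∂μ = -∫ z, B z * RlA l z ∂μ := by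
    intro l hl'
    have h := pinnedChain_resolvent_detailed_balance hω hl.le hβ hγ hN2 hT hϑ0 h2ϑ hA hB hCA hCB hAb hBb hl'
    simp only [hAeven, hBodd, mul_neg, integral_neg] at h
    rw [h, neg_inj]
    exact integral_congr_ae (Eventually.of_forall fun z => mul_comm _ _)
  -- conclude: `|X + Y| ≤ λ · const` for every `λ > 0`, where `X = ∫ A·R₀B`, `Y = ∫ B·R₀A`
  set X : ℝ := ∫ z, A z * RB z ∂μ with hX
  set Y : ℝ := ∫ z, B z * RA z ∂μ with hY
  have hXY : X + Y = 0 := by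
    refine eq_zero_of_abs_le_mul_eps
      (c := K * CB / c ^ 2 * (∫ z, |A z| * E z ∂μ) + K * CA / c ^ 2 * ∫ z, |B z| * E z ∂μ) fun l hl' => ?_
    obtain ⟨hi1, he1⟩ := key hA (d := fun z => RlB l z - RB z) ((hRlBm l).sub hRBm) hwA (hdB hl')
    obtain ⟨hi2, he2⟩ := key hB (d := fun z => RlA l z - RA z) ((hRlAm l).sub hRAm) hwB (hdA hl')
    have hXl : ∫ z, A z * RlB l z ∂μ = X + ∫ z, A z * (RlB l z - RB z) ∂μ := by
      rw [hX, ← integral_add hI1 hi1]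
      exact integral_congr_ae (Eventually.of_forall fun z => by ring)
    have hYl : ∫ z, B z * RlA l z ∂μ = Y + ∫ z, B z * (RlA l z - RA z) ∂μ := by
      rw [hY, ← integral_add hI2 hi2]
      exact integral_congr_ae (Eventually.of_forall fun z => by ring)
    have h := hDB hl'
    rw [hXl, hYl] at h
    have e : X + Y = -(∫ z, A z * (RlB l z - RB z) ∂μ) - ∫ z, B z * (RlA l z - RA z) ∂μ := by linarith
    rw [e]
    calc _ ≤ |-(∫ z, A z * (RlB l z - RB z) ∂μ)| + |∫ z, B z * (RlA l z - RA z) ∂μ| := abs_sub _ _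
      _ ≤ l * (K * CB / c ^ 2) * (∫ z, |A z| * E z ∂μ) + l * (K * CA / c ^ 2) * ∫ z, |B z| * E z ∂μ := by
          rw [abs_neg]; exact add_le_add he1 he2
      _ = _ := by ring
  have hYcomm : ∫ z, RA z * B z ∂μ = Y := integral_congr_ae (Eventually.of_forall fun z => mul_comm _ _)
  rw [hYcomm]
  linarith

/-- **The per-bond Kubo response value is the corrector pairing** (`N ≥ 2`): with the McLennan source
`g = γ(p_0² - p_{N-1}²)/(2T²)` of the two-temperature perturbation and the Kubo corrector
`u⋆ = ∫₀^∞ P_t J dt` of the total current,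
`∫₀^∞ ∫ g · P_s j_i dμ_T ds = ((N-1)T²)⁻¹ ∫ j_i u⋆ dμ_T` for every bond `i`:
Fubini (`= ∫ g · R₀ j_i dμ_T`), detailed balance (`= -∫ R₀ g · j_i dμ_T`), the McLennan identity
`R₀ g = μ_T(Ψ) - Ψ - R₀J/((N-1)T²)` a.e. with the EVEN potential `Ψ = X/((N-1)T²) - H/(2T²)`
(`pinnedChain_kubo_generator_ae_eq`, `pinnedChain_kubo_generator_mclennanPotential`), and parity.
[cite: KunduDharNarayan2009, eqs. (8)–(15)] -/
theorem kuboResponse_eq_corrector_pairing (hN2 : 2 ≤ N) (i : Fin N) :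
    ∫ s in Ioi (0 : ℝ), ∫ x, γ / (2 * T ^ 2) * (x.2 ⟨0, hN⟩ ^ 2 - x.2 ⟨N - 1, by omega⟩ ^ 2) *
        (∫ y, (pinnedChain ω₂ lam β γ).bondCurrent N i y
          ∂((pinnedChain ω₂ lam β γ).transitionKernel N T T s.toNNReal x))
      ∂((pinnedChain ω₂ lam β γ).gibbsMeasure N T) =
    (((N : ℝ) - 1) * T ^ 2)⁻¹ * ∫ z, (pinnedChain ω₂ lam β γ).bondCurrent N i z *
        (∫ t in Ioi (0 : ℝ), ∫ y, (∑ k : Fin N, (pinnedChain ω₂ lam β γ).bondCurrent N k y)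
          ∂((pinnedChain ω₂ lam β γ).transitionKernel N T T t.toNNReal z))
      ∂((pinnedChain ω₂ lam β γ).gibbsMeasure N T) := by
  set P := pinnedChain ω₂ lam β γ with hP
  set μ := P.gibbsMeasure N T with hμ
  set c₀ : ℝ := ((N : ℝ) - 1) * T ^ 2 with hc₀
  set g : PhaseSpace N → ℝ := fun x => γ / (2 * T ^ 2) * (x.2 ⟨0, hN⟩ ^ 2 - x.2 ⟨N - 1, by omega⟩ ^ 2) with hg
  set J : PhaseSpace N → ℝ := fun y => ∑ k : Fin N, P.bondCurrent N k y with hJ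
  set Ψ : PhaseSpace N → ℝ := fun x => c₀⁻¹ * energyMoment P N x + (-(2 * T ^ 2)⁻¹) * P.hamiltonian N x
    with hΨ
  haveI : IsProbabilityMeasure μ := pinnedChain_isProbabilityMeasure_gibbsMeasure hω hl.le hβ.le γ N hT
  obtain ⟨hϑ0, h2ϑ⟩ := quarter_inv_temp_admissible hT
  have hU : ContDiff ℝ ∞ P.U := pinnedChain_contDiff_U ω₂ lam β γ
  have hV : ContDiff ℝ ∞ P.V := pinnedChain_contDiff_V ω₂ lam β γ
  -- niceness, centring and parity of `g`, `j_i`, `Ψ`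
  have hgc : Continuous g := by rw [hg]; fun_prop
  have hgb := pinnedChain_abs_mclennanSource_le hω hl.le hβ.le N (γ := γ) (T := T) hϑ0 ⟨0, hN⟩ ⟨N - 1, by omega⟩
  have hg0 : ∫ y, g y ∂μ = 0 := pinnedChain_integral_mclennanSource_gibbsMeasure hω hl.le hβ hγ hN2 hT
  have hgeven : ∀ y : PhaseSpace N, g (y.1, -y.2) = g y := fun y => by simp [hg]
  have hjc : Continuous (P.bondCurrent N i) := pinnedChain_continuous_bondCurrent ω₂ lam β γ N i
  have hjb := pinnedChain_abs_bondCurrent_le_exp hω.le hl.le hβ.le γ N hϑ0 i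
  have hj0 : ∫ y, P.bondCurrent N i y ∂μ = 0 := pinnedChain_integral_bondCurrent_gibbsMeasure ω₂ lam β γ N T i
  have hjodd : ∀ y : PhaseSpace N, P.bondCurrent N i (y.1, -y.2) = -P.bondCurrent N i y :=
    OscillatorChain.bondCurrent_neg_momentum P N i
  have hΨc : Continuous Ψ :=
    (continuous_const.mul (contDiff_energyMoment P hU hV N).continuous).add
      (continuous_const.mul (pinnedChain_continuous_hamiltonian ω₂ lam β γ N))
  have hΨb := pinnedChain_abs_mclennanPotential_le hω hl.le hβ (γ := γ) (N := N) (T := T) hϑ0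
  have hΨeven : ∀ y : PhaseSpace N, Ψ (y.1, -y.2) = Ψ y := fun y => by
    simp only [hΨ, energyMoment_neg_momentum, OscillatorChain.hamiltonian_neg_momentum]
  -- Step 1: Fubini, `∫₀^∞ ∫ g P_s j_i = ∫ g R₀ j_i`
  have h1 := (integral_crossCorr_eq_integral_mul_kubo hω hl hβ hγ hN hT hgc hgb hjc hjb hj0).2
  -- Step 2: detailed balance, `∫ g R₀ j_i = -∫ R₀ g · j_i`
  have h2 := integral_mul_kubo_detailed_balance_even_odd hω hl hβ hγ hN hT hN2 hgc hjc hgb hjb hg0 hj0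
    hgeven hjodd
  -- Step 3: the McLennan identity `R₀ g = μ_T(Ψ) - Ψ - c₀⁻¹ R₀ J` a.e.
  have h3 : ∀ᵐ z ∂μ, (∫ t in Ioi (0 : ℝ), ∫ y, g y ∂(P.transitionKernel N T T t.toNNReal z)) =
      ((∫ x, Ψ x ∂μ) - Ψ z) - c₀⁻¹ * ∫ t in Ioi (0 : ℝ), ∫ y, J y ∂(P.transitionKernel N T T t.toNNReal z) := by
    filter_upwards [pinnedChain_kubo_generator_ae_eq hω hl.le hβ hγ hN2 hT] with z hz
    have hsplit := pinnedChain_kubo_generator_mclennanPotential hω hl.le hβ hγ hN2 hT z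
    rw [hsplit] at hz
    simp only [hg, hJ, hΨ, hc₀]
    linarith
  -- Step 4: integrate against `j_i` and use parity
  have hint_j : Integrable (P.bondCurrent N i) μ :=
    integrable_of_abs_le_exp (pinnedChain_integrable_exp_mul_hamiltonian_gibbsMeasure hω hl.le hβ.le γ N hT
      (by linarith : 1 / (4 * T) < 1 / T)) hjc hjb
  have hj2 := (pinnedChain_integral_sq_act_le hω hl.le hβ hγ hN hT hϑ0 h2ϑ hjc hjb 0).1
  have hΨ2 := (pinnedChain_integral_sq_act_le hω hl.le hβ hγ hN hT hϑ0 h2ϑ hΨc hΨb 0).1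
  have hint_Ψj : Integrable (fun z => Ψ z * P.bondCurrent N i z) μ :=
    integrable_mul_of_integrable_sq hΨc.aestronglyMeasurable hjc.aestronglyMeasurable hΨ2 hj2
  have hΨj0 : ∫ z, Ψ z * P.bondCurrent N i z ∂μ = 0 := by
    have h := integral_bondCurrent_mul_comp_reversal P N T i Ψ
    simp only [hΨeven] at h
    have h' : ∫ z, P.bondCurrent N i z * Ψ z ∂μ = 0 := by linarith
    simpa only [mul_comm] using h'
  -- integrability of `j_i · R₀ J`
  obtain ⟨K, c, hK0, -, -, hwSM, hKw, -⟩ := corrector_exists hω hl hβ hγ hT hN hϑ0 h2ϑ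
    (fun s z => ∫ y, J y ∂(P.transitionKernel N T T s.toNNReal z)) rfl
    (fun z => ∫ s in Ioi (0 : ℝ), ∫ y, J y ∂(P.transitionKernel N T T s.toNNReal z)) rfl
  have hint_uj : Integrable (fun z => (∫ t in Ioi (0 : ℝ), ∫ y, J y ∂(P.transitionKernel N T T t.toNNReal z)) *
      P.bondCurrent N i z) μ := by
    have hw := pinnedChain_integrable_abs_mul_exp hω hl.le hβ hT h2ϑ hjc hjb
    refine (hw.const_mul K).mono' (hwSM.aestronglyMeasurable.mul hjc.aestronglyMeasurable)
      (Eventually.of_forall fun z => ?_)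
    rw [Real.norm_eq_abs, abs_mul]
    calc |∫ s in Ioi (0 : ℝ), ∫ y, J y ∂(P.transitionKernel N T T s.toNNReal z)| * |P.bondCurrent N i z|
        ≤ (K * Real.exp (1 / (4 * T) * P.hamiltonian N z)) * |P.bondCurrent N i z| :=
          mul_le_mul_of_nonneg_right (hKw z) (abs_nonneg _)
      _ = K * (|P.bondCurrent N i z| * Real.exp (1 / (4 * T) * P.hamiltonian N z)) := by ring
  have h4 : ∫ z, (∫ t in Ioi (0 : ℝ), ∫ y, g y ∂(P.transitionKernel N T T t.toNNReal z)) * P.bondCurrent N i z ∂μ =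
      -(c₀⁻¹ * ∫ z, P.bondCurrent N i z *
        (∫ t in Ioi (0 : ℝ), ∫ y, J y ∂(P.transitionKernel N T T t.toNNReal z)) ∂μ) := by
    have hae : ∫ z, (∫ t in Ioi (0 : ℝ), ∫ y, g y ∂(P.transitionKernel N T T t.toNNReal z)) * P.bondCurrent N i z ∂μ =
        ∫ z, ((∫ x, Ψ x ∂μ) * P.bondCurrent N i z - Ψ z * P.bondCurrent N i z -
          c₀⁻¹ * ((∫ t in Ioi (0 : ℝ), ∫ y, J y ∂(P.transitionKernel N T T t.toNNReal z)) *
            P.bondCurrent N i z)) ∂μ := by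
      refine integral_congr_ae ?_
      filter_upwards [h3] with z hz
      rw [hz]; ring
    have i1 : Integrable (fun z => (∫ x, Ψ x ∂μ) * P.bondCurrent N i z - Ψ z * P.bondCurrent N i z) μ :=
      (hint_j.const_mul _).sub hint_Ψj
    have i2 : Integrable (fun z => c₀⁻¹ * ((∫ t in Ioi (0 : ℝ), ∫ y, J y
        ∂(P.transitionKernel N T T t.toNNReal z)) * P.bondCurrent N i z)) μ := hint_uj.const_mul _
    rw [hae, integral_sub i1 i2, integral_sub (hint_j.const_mul _) hint_Ψj, integral_const_mul,
      integral_const_mul, hj0, hΨj0]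
    simp only [mul_zero, sub_zero, zero_sub, mul_comm (P.bondCurrent N i _)]
  rw [h1, h2, h4, neg_neg]

end KuboResponse

/-! ## The registered sub-goal: the stub from the per-bond Kubo response -/

/-- **Registered sub-goal `stub_anchoredKuboOfKuboResponse`.** The hypotheses of the registered
stub S3 `stub_anchoredKubo`, plus — at the given `T` and `N ≥ 2` — the PER-BOND LINEAR RESPONSE IN
KUBO FORM `δ⁻¹(μ_δ(j_i) - μ_{T,T}(j_i)) → ∫₀^∞ ∫ g · P_s j_i dμ_T ds` for every bond `i`
(`g = γ(p_0² - p_{N-1}²)/(2T²)`), imply the stub's conclusion: conjunct (1) is part 1; for (2),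
`Dn N = Σ_i ∫₀^∞ ∫ g · P_s j_i dμ_T ds` (uniqueness of limits; no current at equilibrium under
uniqueness) `= ((N-1)T²)⁻¹ Σ_i ∫ j_i u⋆ dμ_T` (§5) `= T⁻² ∫ j_c u⋆ dμ_T` (DC-flatness, part 2)
`= T⁻² Σ_k ∫₀^∞ ⟨j_c(0) j_k(t)⟩ dt` (Fubini, part 1). [cite: KunduDharNarayan2009, eqs. (8)–(15)] -/
theorem stub_anchoredKuboOfKuboResponse :
    ∀ ω₂ lam β γ : ℝ, 0 < ω₂ → 0 < lam → 0 < β → 0 < γ →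
      (∀ (N : ℕ) (T_L T_R : ℝ), 0 < T_L → 0 < T_R →
        ∀ μ ν : MeasureTheory.Measure
            (Literature.MathematicalPhysics.KineticTheory.HeatConduction.PhaseSpace N),
          (Literature.MathematicalPhysics.KineticTheory.HeatConduction.pinnedChain ω₂ lam β γ).IsSteadyState N T_L T_R μ →
          (Literature.MathematicalPhysics.KineticTheory.HeatConduction.pinnedChain ω₂ lam β γ).IsSteadyState N T_L T_R ν → μ = ν) →
      ∀ T : ℝ, 0 < T →
      ∀ (μ : (N : ℕ) → ℝ → ℝ → MeasureTheory.Measure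
            (Literature.MathematicalPhysics.KineticTheory.HeatConduction.PhaseSpace N))
        (Dn : ℕ → ℝ),
        (∀ (N : ℕ) (T_L T_R : ℝ), 0 < T_L → 0 < T_R →
          (Literature.MathematicalPhysics.KineticTheory.HeatConduction.pinnedChain ω₂ lam β γ).IsSteadyState N T_L T_R (μ N T_L T_R)) →
        (∀ N : ℕ, Filter.Tendsto (fun δ : ℝ =>
            (Literature.MathematicalPhysics.KineticTheory.HeatConduction.pinnedChain ω₂ lam β γ).totalCurrent (μ N (T + δ / 2) (T - δ / 2)) / δ)
          (nhdsWithin 0 {(0 : ℝ)}ᶜ) (nhds (Dn N))) →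
        ∀ (N : ℕ) (hN : 2 ≤ N),
          (∀ i : Fin N, Filter.Tendsto (fun δ : ℝ =>
              ((∫ x, (Literature.MathematicalPhysics.KineticTheory.HeatConduction.pinnedChain ω₂ lam β γ).bondCurrent N i x ∂(μ N (T + δ / 2) (T - δ / 2))) -
                ∫ x, (Literature.MathematicalPhysics.KineticTheory.HeatConduction.pinnedChain ω₂ lam β γ).bondCurrent N i x ∂(μ N T T)) / δ)
            (nhdsWithin 0 {(0 : ℝ)}ᶜ)
            (nhds (∫ s in Set.Ioi (0 : ℝ),
              ∫ x, γ / (2 * T ^ 2) * (x.2 ⟨0, by omega⟩ ^ 2 - x.2 ⟨N - 1, by omega⟩ ^ 2) *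
                (∫ y, (Literature.MathematicalPhysics.KineticTheory.HeatConduction.pinnedChain ω₂ lam β γ).bondCurrent N i y
                  ∂((Literature.MathematicalPhysics.KineticTheory.HeatConduction.pinnedChain ω₂ lam β γ).transitionKernel N T T s.toNNReal x))
              ∂((Literature.MathematicalPhysics.KineticTheory.HeatConduction.pinnedChain ω₂ lam β γ).gibbsMeasure N T)))) →
          (∀ i k : Fin N, MeasureTheory.IntegrableOn (fun t : ℝ =>
              ∫ z, (Literature.MathematicalPhysics.KineticTheory.HeatConduction.pinnedChain ω₂ lam β γ).bondCurrent N i z *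
                (∫ y, (Literature.MathematicalPhysics.KineticTheory.HeatConduction.pinnedChain ω₂ lam β γ).bondCurrent N k y
                  ∂((Literature.MathematicalPhysics.KineticTheory.HeatConduction.pinnedChain ω₂ lam β γ).transitionKernel N T T t.toNNReal z))
              ∂((Literature.MathematicalPhysics.KineticTheory.HeatConduction.pinnedChain ω₂ lam β γ).gibbsMeasure N T)) (Set.Ioi 0)) ∧
          T ^ 2 * Dn N = ∑ k : Fin N, ∫ t in Set.Ioi (0 : ℝ),
              ∫ z, (Literature.MathematicalPhysics.KineticTheory.HeatConduction.pinnedChain ω₂ lam β γ).bondCurrent N ⟨(N - 1) / 2, by omega⟩ z *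
                (∫ y, (Literature.MathematicalPhysics.KineticTheory.HeatConduction.pinnedChain ω₂ lam β γ).bondCurrent N k y
                  ∂((Literature.MathematicalPhysics.KineticTheory.HeatConduction.pinnedChain ω₂ lam β γ).transitionKernel N T T t.toNNReal z))
              ∂((Literature.MathematicalPhysics.KineticTheory.HeatConduction.pinnedChain ω₂ lam β γ).gibbsMeasure N T) := by
  intro ω₂ lam β γ hω hl hβ hγ hU T hT μ Dn hμ hDn N hN hKR
  have hN0 : 0 < N := by omega
  refine ⟨fun i k => stub_anchoredKuboPairCorr ω₂ lam β γ hω hl hβ hγ T hT N hN0 i k, ?_⟩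
  have hN1 : (0 : ℝ) < (N : ℝ) - 1 := by
    have : (2 : ℝ) ≤ N := by exact_mod_cast hN
    linarith
  have hμ0 : μ N T T = (pinnedChain ω₂ lam β γ).gibbsMeasure N T :=
    FiniteResponse.steadyState_eq_gibbsMeasure_of_unique hω hl.le hβ.le hT (hU N T T hT hT) (hμ N T T hT hT)
  have h0 : ∀ i : Fin N, ∫ x, (pinnedChain ω₂ lam β γ).bondCurrent N i x ∂(μ N T T) = 0 := fun i => by
    rw [hμ0]; exact pinnedChain_integral_bondCurrent_gibbsMeasure ω₂ lam β γ N T i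
  have hsum := FiniteResponse.tendsto_response_of_bond_quotients (pinnedChain ω₂ lam β γ) (μ N) T _ h0 hKR
  have hD := tendsto_nhds_unique (hDn N) hsum
  rw [hD]
  rw [Finset.sum_congr rfl fun (i : Fin N) _ => kuboResponse_eq_corrector_pairing hω hl hβ hγ hN0 hT hN i]
  have hc : ((⟨(N - 1) / 2, by omega⟩ : Fin N)).val + 1 < N := by
    show (N - 1) / 2 + 1 < N
    omega
  obtain ⟨hϑ0, -⟩ := quarter_inv_temp_admissible hT
  rw [← Finset.mul_sum, stub_anchoredKuboFlatness ω₂ lam β γ hω hl hβ hγ T hT N ⟨(N - 1) / 2, by omega⟩ hc,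
    sum_integral_crossCorr_eq_integral_mul_kubo hω hl hβ hγ hN0 hT
      (pinnedChain_continuous_bondCurrent ω₂ lam β γ N _)
      (pinnedChain_abs_bondCurrent_le_exp hω.le hl.le hβ.le γ N hϑ0 _)]
  have hN1' : (N : ℝ) - 1 ≠ 0 := hN1.ne'
  have hT' : T ≠ 0 := hT.ne'
  field_simp

end Summit.AtomisticToContinuum.FouriersLaw.Theorems.AbelThermodynamicLimit.LoomisCompactHorizonWitness

end
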